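import Summits.QuantumFields.YangMills.Theorems.UnitScaleTiltFluctuationComparisonRegPrPrintChiSocket
import Summits.QuantumFields.YangMills.Theorems.UnitScaleTiltFluctuationComparisonRegPrPrintChiDescent
import HarnessLib

/-!
# `UnitScaleTiltFluctuationComparisonRegPrPrintChiLine` — STUB 4′ of crux `FluctuationComparisonRegPrL` (stmt-QuantumFields-19935), repair (R1) «print's χ
# of [Balaban1985UV3] (47) back», part 4: the χ-restricted CAUCHY socket, the descent sandwich with the doubly-χ-good set one level down, and the
# ASSEMBLY of the per-cut-off descent data into the body of 4′

Cell `ym3-torus`, width-lever lane `ym-ust-19935-r1`; siblings `…PrintChi` (p528527: `ChiGood`, heredity, transfer, `TwoSidedRepOn`), `…PrintChiSocket` (p529532: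
χ-socket for one family, 4′ verbatim from inner-on-χ + edge-off-χ), `…PrintChiDescent` (p529535: the one-step descent sandwich on the tree's objects).  Count-neutral
helper (`--supports stmt-QuantumFields-19935`).  Pure bookkeeping; no estimate of [Balaban1985UV3]/[King1986] is asserted; no numerics.

* §7 `PintCauchyOn S` — the cell's cut-off-Cauchy socket `T3LogComparisonSocket.PintCauchyAt` ([King1986] Thm 3.4 shape) with its a.e. clause asserted only on data
  in `S_K ∩ S_{K+1}` (to be the doubly-χ-good data: at `L ∈ {3,5}` the two-run Cauchy property of the interaction terms is King's mechanism on χ-good data and a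
  large-deviation question off them); `pintCauchyOn_of_cauchyAt`; `stubBodyOn_of_repOn_of_cauchyOn` (BOTH sockets restricted ⇒ the 4′ inequality a.e. on
  `Win ∩ S_K ∩ S_{K+1}`); `stub_logComparisonSmallBlocks_of_repOnChi_cauchyOnChi_edge` — THE REGISTERED 4′ TEXT from fully χ-restricted inner data + the edge clause.
* §8 `fourPrime_pair_of_chi_descent` — `…PrintChiDescent.fourPrime_pair_of_descent` with the good set inside the doubly-χ-good fields one level down: the sandwich is
  assumed on χ-good data only (where both runs' representations hold at every block size, `…PrintChi` §2–§3).
* §9 `fourPrimeBody_of_descent_family` — ASSEMBLY: per-cut-off descent data for every `K ≥ 1` (good sets `G_K`, sandwich constants `κ_K`, summable radii `r_K`, summable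
  bad masses `δ_K ≤ ½`), the minimiser-stability schema `MinimiserStabilityRegPrAt` at the comparison heights (crux `MinimiserStabilityRegPr`'s per-family body) and a
  bound for the descent-free cut-off `K = 0` give the BODY of 4′ for `(F, γ, b₀, p₀, m, ε₀)` (`m ≥ 2`) — `Σ_K (r_K − log(1−δ_K) + r₃_K) < ∞` by `−log(1−δ) ≤ 2δ` on `[0, ½]`.

WHAT THIS IS NOT: not a proof of 4′ — the per-cut-off sandwich one level down (lane currency on χ-good data) and the conditional χ-bad masses (card C6's
`ConditionalEdgeMass`, located-unprinted) are hypotheses; not a restatement of 4′ (§7's conclusion IS the registered text; §9's is its body for one family).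

References: C. King, CMP 102 (1986) 649–677 [King1986] (Thm 3.4 (3.9) p.656, Props 3.8–3.9 pp.664–665); T. Bałaban, CMP 102 (1985) 255–275 [Balaban1985UV3] ((47) p.267).
-/

noncomputable section

namespace Summit.QuantumFields.YangMills.Theorems.PrintChi

open MeasureTheory Filter
open Literature.MathematicalPhysics.QuantumFieldTheory.Balaban1983to89
open Literature.MathematicalPhysics.QuantumFieldTheory.Balaban1983to89.T3ContinuumYM3Torus
open Literature.MathematicalPhysics.QuantumFieldTheory.Balaban1983to89.T3UnitLawDensityEML (ℰp measurableE_ℰp)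
open Literature.MathematicalPhysics.QuantumFieldTheory.Balaban1983to89.T3UnitScaleTilt
open Literature.MathematicalPhysics.QuantumFieldTheory.Balaban1983to89.T3TiltDescent
open Literature.MathematicalPhysics.QuantumFieldTheory.Balaban1983to89.T3RegularMinimiser
open Literature.MathematicalPhysics.QuantumFieldTheory.Balaban1983to89.T3PrintedRegularMinimiser
open Literature.MathematicalPhysics.QuantumFieldTheory.Balaban1983to89.T3LogComparisonSocket
open Summit.QuantumFields.YangMills.Theorems.PrintChiDescent

/-! ## §7 The χ-restricted Cauchy socket and the fully restricted inner piece -/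

section CauchyOn

variable (F : T3Family) (γ b₀ p₀ : ℝ)

/-- **THE CUT-OFF-CAUCHY PROPERTY OF THE INTERACTION TERMS ON A SUB-PREDICATE** (hypothesis schema, never asserted): the cell's `PintCauchyAt` ([King1986]
Thm 3.4 (3.9) shape for Bałaban's interaction sums of two consecutive cut-offs) with its a.e. clause asserted only at data satisfying `S K n h V` for BOTH runs
(`n = ⌊K/m⌋`) — to be the doubly-χ-good data. [cite: King1986, Thm 3.4 (3.9) p.656] -/
def PintCauchyOn (S : (K n : ℕ) → n ≤ K → GaugeField (F.P n) 0 (Matrix.specialUnitaryGroup (Fin 2) ℂ) → Prop) (m : ℕ)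
    (Pint : (K n : ℕ) → GaugeField (F.P n) 0 (Matrix.specialUnitaryGroup (Fin 2) ℂ) → ℝ) : Prop :=
  ∃ (r' c : ℕ → ℝ), Summable r' ∧ (∀ K, 0 ≤ r' K) ∧
    ∀ K, ∀ᵐ V ∂fieldMeasure (F.P (K / m)) 0 (Matrix.specialUnitaryGroup (Fin 2) ℂ),
      PlaqSmall (θBal F.L γ b₀ p₀ (K / m)) V →
        S K (K / m) (Nat.div_le_self K m) V → S (K + 1) (K / m) ((Nat.div_le_self K m).trans (Nat.le_succ K)) V →
        0 < heightDensity F γ (Nat.div_le_self K m) (histGood F ℰp (θBal F.L γ b₀ p₀) K (K / m)) V →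
        0 < heightDensity F γ ((Nat.div_le_self K m).trans (Nat.le_succ K))
              (histGood F ℰp (θBal F.L γ b₀ p₀) (K + 1) (K / m)) V → |Pint (K + 1) (K / m) V - Pint K (K / m) V - c K| ≤ r' K

variable {F γ b₀ p₀}

/-- The full-window Cauchy socket implies the restricted one for every `S`. [cite: King1986, Thm 3.4 (3.9) p.656] -/
theorem pintCauchyOn_of_cauchyAt (S : (K n : ℕ) → n ≤ K → GaugeField (F.P n) 0 (Matrix.specialUnitaryGroup (Fin 2) ℂ) → Prop) {m : ℕ}
    {Pint : (K n : ℕ) → GaugeField (F.P n) 0 (Matrix.specialUnitaryGroup (Fin 2) ℂ) → ℝ} (h : PintCauchyAt F γ b₀ p₀ m Pint) :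
    PintCauchyOn F γ b₀ p₀ S m Pint := by
  obtain ⟨r', c, hr', hr'0, hae⟩ := h
  refine ⟨r', c, hr', hr'0, fun K => ?_⟩
  filter_upwards [hae K] with V hV
  exact fun hs _ _ h0 h0' => hV hs h0 h0'

/-- **THE FULLY RESTRICTED SOCKET FOR ONE FAMILY**: `TwoSidedRepOn S …` ∧ `PintCauchyOn S …` (`m ≥ 1`) ⇒ the 4′ inequality a.e. on `Win ∩ S_K ∩ S_{K+1}` (both densities
positive), `κ_K := c_K − E (K+1) n + E K n`, `r_K := Rm (K+1) n + Rm K n + r′_K`. [cite: King1986, Thm 3.4 (3.9) p.656] -/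
theorem stubBodyOn_of_repOn_of_cauchyOn (F : T3Family) (γ b₀ p₀ ε₀ : ℝ) {m : ℕ} (hm : 0 < m)
    (S : (K n : ℕ) → n ≤ K → GaugeField (F.P n) 0 (Matrix.specialUnitaryGroup (Fin 2) ℂ) → Prop)
    (Pint : (K n : ℕ) → GaugeField (F.P n) 0 (Matrix.specialUnitaryGroup (Fin 2) ℂ) → ℝ) (E Rm : ℕ → ℕ → ℝ)
    (hrep : TwoSidedRepOn F γ b₀ p₀ S ε₀ Pint E Rm) (hcauchy : PintCauchyOn F γ b₀ p₀ S m Pint) :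
    ∃ (r κ : ℕ → ℝ), Summable r ∧ (∀ K, 0 ≤ r K) ∧
      ∀ K, ∀ᵐ V ∂fieldMeasure (F.P (K / m)) 0 (Matrix.specialUnitaryGroup (Fin 2) ℂ),
        PlaqSmall (θBal F.L γ b₀ p₀ (K / m)) V →
          S K (K / m) (Nat.div_le_self K m) V → S (K + 1) (K / m) ((Nat.div_le_self K m).trans (Nat.le_succ K)) V →
          0 < heightDensity F γ (Nat.div_le_self K m) (histGood F ℰp (θBal F.L γ b₀ p₀) K (K / m)) V →
          0 < heightDensity F γ ((Nat.div_le_self K m).trans (Nat.le_succ K))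
                (histGood F ℰp (θBal F.L γ b₀ p₀) (K + 1) (K / m)) V →
            |(Real.log (heightDensity F γ ((Nat.div_le_self K m).trans (Nat.le_succ K))
                  (histGood F ℰp (θBal F.L γ b₀ p₀) (K + 1) (K / m)) V) + bgRegPr' F γ m ε₀ K V) -
              (Real.log (heightDensity F γ (Nat.div_le_self K m) (histGood F ℰp (θBal F.L γ b₀ p₀) K (K / m)) V) + bgRegPr F γ m ε₀ K V) -
                κ K| ≤ r K := by
  obtain ⟨hRm0, hRsum, hR⟩ := hrep
  obtain ⟨r', c, hr', hr'0, hC⟩ := hcauchy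
  have hsum : Summable fun K : ℕ => Rm (K + 1) (K / m) + Rm K (K / m) + r' K := by
    have h := (hRsum m hm).add hr'
    refine h.congr fun K => ?_
    ring
  refine ⟨fun K => Rm (K + 1) (K / m) + Rm K (K / m) + r' K, fun K => c K - E (K + 1) (K / m) + E K (K / m),
    hsum, fun K => add_nonneg (add_nonneg (hRm0 _ _) (hRm0 _ _)) (hr'0 K), fun K => ?_⟩
  filter_upwards [hR K (K / m) (Nat.div_le_self K m), hR (K + 1) (K / m) ((Nat.div_le_self K m).trans (Nat.le_succ K)), hC K]
    with V hK hK1 hc hs hS hS' h0 h0'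
  have hy := hK hs hS h0
  have hx := hK1 hs hS' h0'
  have hPc := hc hs hS hS' h0 h0'
  have key : ∀ x y P₀ P₁ E₀ E₁ c₀ : ℝ, x - y - (c₀ - E₁ + E₀) = (x - P₁ + E₁) - (y - P₀ + E₀) + (P₁ - P₀ - c₀) := by
    intros
    ring
  rw [bgRegPr'_eq, bgRegPr_eq, key _ _ (Pint K (K / m) V) (Pint (K + 1) (K / m) V) (E K (K / m)) (E (K + 1) (K / m)) (c K)]
  exact (abs_add_le _ _).trans (add_le_add ((abs_sub _ _).trans (add_le_add hx hy)) hPc)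

/-- **STUB 4′ FROM FULLY χ-RESTRICTED INNER DATA + THE EDGE CLAUSE**: (i″) below the 4′ thresholds every family carries interaction data with the two-sided
representation AND the cut-off-Cauchy property asserted ON THE DOUBLY-χ-GOOD DATA ONLY (`TwoSidedRepOn χ`, `PintCauchyOn χ`), (ii) the edge-oscillation clause off
the doubly-χ-good set; conclusion: the registered 4′ text verbatim (§7 socket into `…PrintChiSocket`'s `stub_logComparisonSmallBlocks_of_chi_edge`). [cite: King1986, Thm 3.4 (3.9) p.656] -/
theorem stub_logComparisonSmallBlocks_of_repOnChi_cauchyOnChi_edge (μ : ℕ → ℝ)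
    (hRep : ∀ (L : ℕ), Odd L → 1 < L → L < 7 → ∃ (b₁ p₁ : ℝ), ∀ (b₀ p₀ : ℝ), b₁ ≤ b₀ → p₁ ≤ p₀ → 0 < b₀ → 2 < p₀ →
      ∃ ε₁ : ℝ, 0 < ε₁ ∧ ∀ (ε₀ : ℝ), 0 < ε₀ → ε₀ ≤ ε₁ → ∃ m₀ : ℕ, ∀ (m : ℕ), m₀ ≤ m →
        ∃ γ₁ : ℝ, 0 < γ₁ ∧ ∀ (F : T3Family) (γ : ℝ), F.L = L → 0 < γ → γ ≤ γ₁ →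
          ∃ (Pint : (K n : ℕ) → GaugeField (F.P n) 0 (Matrix.specialUnitaryGroup (Fin 2) ℂ) → ℝ) (E Rm : ℕ → ℕ → ℝ),
            TwoSidedRepOn F γ b₀ p₀ (fun K n h V => ChiGood F γ b₀ p₀ ε₀ (μ L) (n := n) (K := K) h V) ε₀ Pint E Rm ∧
              PintCauchyOn F γ b₀ p₀ (fun K n h V => ChiGood F γ b₀ p₀ ε₀ (μ L) (n := n) (K := K) h V) m Pint)
    (hEdge : ∀ (L : ℕ), Odd L → 1 < L → L < 7 → ∃ (b₁ p₁ : ℝ), ∀ (b₀ p₀ : ℝ), b₁ ≤ b₀ → p₁ ≤ p₀ → 0 < b₀ → 2 < p₀ →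
      ∃ ε₁ : ℝ, 0 < ε₁ ∧ ∀ (ε₀ : ℝ), 0 < ε₀ → ε₀ ≤ ε₁ → ∃ m₀ : ℕ, ∀ (m : ℕ), m₀ ≤ m →
        ∃ γ₁ : ℝ, 0 < γ₁ ∧ ∀ (F : T3Family) (γ : ℝ), F.L = L → 0 < γ → γ ≤ γ₁ →
          ∃ r' : ℕ → ℝ, Summable r' ∧ (∀ K, 0 ≤ r' K) ∧ ∀ K, ∃ c : ℝ,
            (∀ᵐ V ∂fieldMeasure (F.P (K / m)) 0 (Matrix.specialUnitaryGroup (Fin 2) ℂ),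
              PlaqSmall (θBal F.L γ b₀ p₀ (K / m)) V →
                ¬ (ChiGood F γ b₀ p₀ ε₀ (μ L) (Nat.div_le_self K m) V ∧
                    ChiGood F γ b₀ p₀ ε₀ (μ L) ((Nat.div_le_self K m).trans (Nat.le_succ K)) V) →
                0 < heightDensity F γ (Nat.div_le_self K m) (histGood F ℰp (θBal F.L γ b₀ p₀) K (K / m)) V →
                0 < heightDensity F γ ((Nat.div_le_self K m).trans (Nat.le_succ K))
                      (histGood F ℰp (θBal F.L γ b₀ p₀) (K + 1) (K / m)) V →
                  |(Real.log (heightDensity F γ ((Nat.div_le_self K m).trans (Nat.le_succ K))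
                        (histGood F ℰp (θBal F.L γ b₀ p₀) (K + 1) (K / m)) V) + bgRegPr' F γ m ε₀ K V) -
                    (Real.log (heightDensity F γ (Nat.div_le_self K m) (histGood F ℰp (θBal F.L γ b₀ p₀) K (K / m)) V) + bgRegPr F γ m ε₀ K V) -
                      c| ≤ r' K) ∧
            (∃ᵐ V ∂fieldMeasure (F.P (K / m)) 0 (Matrix.specialUnitaryGroup (Fin 2) ℂ),
              (PlaqSmall (θBal F.L γ b₀ p₀ (K / m)) V ∧
                ChiGood F γ b₀ p₀ ε₀ (μ L) (Nat.div_le_self K m) V ∧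
                ChiGood F γ b₀ p₀ ε₀ (μ L) ((Nat.div_le_self K m).trans (Nat.le_succ K)) V) ∧
                0 < heightDensity F γ (Nat.div_le_self K m) (histGood F ℰp (θBal F.L γ b₀ p₀) K (K / m)) V ∧
                0 < heightDensity F γ ((Nat.div_le_self K m).trans (Nat.le_succ K))
                      (histGood F ℰp (θBal F.L γ b₀ p₀) (K + 1) (K / m)) V ∧
                  |(Real.log (heightDensity F γ ((Nat.div_le_self K m).trans (Nat.le_succ K))
                        (histGood F ℰp (θBal F.L γ b₀ p₀) (K + 1) (K / m)) V) + bgRegPr' F γ m ε₀ K V) -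
                    (Real.log (heightDensity F γ (Nat.div_le_self K m) (histGood F ℰp (θBal F.L γ b₀ p₀) K (K / m)) V) + bgRegPr F γ m ε₀ K V) -
                      c| ≤ r' K)) :
    ∀ (L : ℕ), Odd L → 1 < L → L < 7 → ∃ (b₁ p₁ : ℝ), ∀ (b₀ p₀ : ℝ), b₁ ≤ b₀ → p₁ ≤ p₀ → 0 < b₀ → 2 < p₀ →
      ∃ ε₁ : ℝ, 0 < ε₁ ∧ ∀ (ε₀ : ℝ), 0 < ε₀ → ε₀ ≤ ε₁ → ∃ m₀ : ℕ, ∀ (m : ℕ), m₀ ≤ m →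
        ∃ γ₁ : ℝ, 0 < γ₁ ∧ ∀ (F : T3Family) (γ : ℝ), F.L = L → 0 < γ → γ ≤ γ₁ →
          ∃ (r κ : ℕ → ℝ), Summable r ∧ (∀ K, 0 ≤ r K) ∧
            ∀ K, ∀ᵐ V ∂fieldMeasure (F.P (K / m)) 0 (Matrix.specialUnitaryGroup (Fin 2) ℂ),
              PlaqSmall (θBal F.L γ b₀ p₀ (K / m)) V →
                0 < heightDensity F γ (Nat.div_le_self K m) (histGood F ℰp (θBal F.L γ b₀ p₀) K (K / m)) V →
                0 < heightDensity F γ ((Nat.div_le_self K m).trans (Nat.le_succ K))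
                      (histGood F ℰp (θBal F.L γ b₀ p₀) (K + 1) (K / m)) V →
                  |(Real.log (heightDensity F γ ((Nat.div_le_self K m).trans (Nat.le_succ K))
                        (histGood F ℰp (θBal F.L γ b₀ p₀) (K + 1) (K / m)) V) + bgRegPr' F γ m ε₀ K V) -
                    (Real.log (heightDensity F γ (Nat.div_le_self K m) (histGood F ℰp (θBal F.L γ b₀ p₀) K (K / m)) V) + bgRegPr F γ m ε₀ K V) -
                      κ K| ≤ r K := by
  refine stub_logComparisonSmallBlocks_of_chi_edge μ (fun L hLo hL hL7 => ?_) hEdge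
  obtain ⟨b₁, p₁, H⟩ := hRep L hLo hL hL7
  refine ⟨b₁, p₁, fun b₀ p₀ hb hp hb₀ hp₀ => ?_⟩
  obtain ⟨ε₁, hε₁, H'⟩ := H b₀ p₀ hb hp hb₀ hp₀
  refine ⟨ε₁, hε₁, fun ε₀ hε₀ hε₀le => ?_⟩
  obtain ⟨m₀, Hm⟩ := H' ε₀ hε₀ hε₀le
  refine ⟨max m₀ 1, fun m hm => ?_⟩
  have hmpos : 0 < m := Nat.lt_of_lt_of_le Nat.one_pos ((le_max_right _ _).trans hm)
  obtain ⟨γ₁, hγ₁, HF⟩ := Hm m ((le_max_left _ _).trans hm)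
  refine ⟨γ₁, hγ₁, fun F γ hFL hγ hγle => ?_⟩
  obtain ⟨Pint, E, Rm, hrep, hcau⟩ := HF F γ hFL hγ hγle
  obtain ⟨r, κ, hr, hr0, hC⟩ := stubBodyOn_of_repOn_of_cauchyOn F γ b₀ p₀ ε₀ hmpos _ Pint E Rm hrep hcau
  refine ⟨r, κ, hr, hr0, fun K => ?_⟩
  filter_upwards [hC K] with V hV
  intro hs hχ hχ' h0 h0'
  exact hV hs hχ hχ' h0 h0'

end CauchyOn

/-! ## §8 The descent sandwich with the doubly-χ-good set one level down -/

section ChiDescent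

variable (F : T3Family) {γ : ℝ}

/-- **ONE CUT-OFF PAIR OF 4′ BY DESCENT ON χ-GOOD DATA ONE LEVEL DOWN**: as `…PrintChiDescent.fourPrime_pair_of_descent`, with the two-run sandwich assumed only
at level-`(n+1)` data that are χ-good for BOTH runs (margin `μ`; where both runs' representations are consistent at every block size) and a measurable good set
`G` INSIDE the doubly-χ-good set whose complement has conditional mass `≤ δ < 1` in the fibres of both runs. [cite: King1986, Thm 3.4 (3.9) p.656] -/
theorem fourPrime_pair_of_chi_descent (hγ : 0 ≤ γ) (b₀ p₀ ε₀ μ : ℝ) {m K : ℕ} (h : K / m + 1 ≤ K)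
    {G : Set (GaugeField (F.P (K / m + 1)) 0 (Matrix.specialUnitaryGroup (Fin 2) ℂ))} (hG : MeasurableSet G)
    (hGχ : G ⊆ {W | ChiGood F γ b₀ p₀ ε₀ μ h W ∧ ChiGood F γ b₀ p₀ ε₀ μ (h.trans (Nat.le_succ K)) W})
    {κ r δ κ₃ r₃ : ℝ} (hδ : δ < 1)
    (hcmp : ∀ᵐ W ∂fieldMeasure (F.P (K / m + 1)) 0 (Matrix.specialUnitaryGroup (Fin 2) ℂ),
      ChiGood F γ b₀ p₀ ε₀ μ h W → ChiGood F γ b₀ p₀ ε₀ μ (h.trans (Nat.le_succ K)) W →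
      Real.exp (κ - r) * heightDensity F γ h (histGood F ℰp (θBal F.L γ b₀ p₀) K (K / m)) W ≤
          heightDensity F γ (h.trans (Nat.le_succ K)) (histGood F ℰp (θBal F.L γ b₀ p₀) (K + 1) (K / m)) W ∧
        heightDensity F γ (h.trans (Nat.le_succ K)) (histGood F ℰp (θBal F.L γ b₀ p₀) (K + 1) (K / m)) W ≤
          Real.exp (κ + r) * heightDensity F γ h (histGood F ℰp (θBal F.L γ b₀ p₀) K (K / m)) W)
    (hbadA : ∀ s, MeasurableSet s →
      ∫ W in (descendTo F ℰp (K / m) (K / m + 1) (Nat.le_succ _)) ⁻¹' s ∩ Gᶜ,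
          heightDensity F γ h (histGood F ℰp (θBal F.L γ b₀ p₀) K (K / m)) W ∂fieldMeasure (F.P (K / m + 1)) 0 (Matrix.specialUnitaryGroup (Fin 2) ℂ) ≤
        δ * ∫ V in s, heightDensity F γ (Nat.div_le_self K m) (histGood F ℰp (θBal F.L γ b₀ p₀) K (K / m)) V
          ∂fieldMeasure (F.P (K / m)) 0 (Matrix.specialUnitaryGroup (Fin 2) ℂ))
    (hbadB : ∀ s, MeasurableSet s →
      ∫ W in (descendTo F ℰp (K / m) (K / m + 1) (Nat.le_succ _)) ⁻¹' s ∩ Gᶜ,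
          heightDensity F γ (h.trans (Nat.le_succ K)) (histGood F ℰp (θBal F.L γ b₀ p₀) (K + 1) (K / m)) W
          ∂fieldMeasure (F.P (K / m + 1)) 0 (Matrix.specialUnitaryGroup (Fin 2) ℂ) ≤
        δ * ∫ V in s, heightDensity F γ ((Nat.div_le_self K m).trans (Nat.le_succ K)) (histGood F ℰp (θBal F.L γ b₀ p₀) (K + 1) (K / m)) V
          ∂fieldMeasure (F.P (K / m)) 0 (Matrix.specialUnitaryGroup (Fin 2) ℂ))
    (hmin : ∀ V : GaugeField (F.P (K / m)) 0 (Matrix.specialUnitaryGroup (Fin 2) ℂ), PlaqSmall (θBal F.L γ b₀ p₀ (K / m)) V →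
      |bgRegPr' F γ m ε₀ K V - bgRegPr F γ m ε₀ K V - κ₃| ≤ r₃) :
    ∀ᵐ V ∂fieldMeasure (F.P (K / m)) 0 (Matrix.specialUnitaryGroup (Fin 2) ℂ),
      PlaqSmall (θBal F.L γ b₀ p₀ (K / m)) V →
        0 < heightDensity F γ (Nat.div_le_self K m) (histGood F ℰp (θBal F.L γ b₀ p₀) K (K / m)) V →
        0 < heightDensity F γ ((Nat.div_le_self K m).trans (Nat.le_succ K)) (histGood F ℰp (θBal F.L γ b₀ p₀) (K + 1) (K / m)) V →
          |(Real.log (heightDensity F γ ((Nat.div_le_self K m).trans (Nat.le_succ K))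
                (histGood F ℰp (θBal F.L γ b₀ p₀) (K + 1) (K / m)) V) + bgRegPr' F γ m ε₀ K V) -
            (Real.log (heightDensity F γ (Nat.div_le_self K m) (histGood F ℰp (θBal F.L γ b₀ p₀) K (K / m)) V) + bgRegPr F γ m ε₀ K V) -
              (κ + κ₃)| ≤ (r - Real.log (1 - δ)) + r₃ :=
  fourPrime_pair_of_descent F hγ b₀ p₀ ε₀ h hG hδ
    (by
      filter_upwards [hcmp] with W hW hWG
      exact hW (hGχ hWG).1 (hGχ hWG).2)
    hbadA hbadB hmin

end ChiDescent

/-! ## §9 Assembly: the per-cut-off descent data for every `K ≥ 1` + the minimiser-stability schema + the cut-off `K = 0` ⇒ the body of 4′ -/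

section Assembly

variable (F : T3Family) {γ : ℝ}

/-- `⌊K/m⌋ + 1 ≤ K` for `K ≥ 1` and `m ≥ 2`: below every positive cut-off there is room for one descent step at the route's comparison height. [folklore] -/
theorem div_succ_le {m K : ℕ} (hm : 2 ≤ m) (hK : 1 ≤ K) : K / m + 1 ≤ K := by
  have h1 : K / m ≤ K / 2 := Nat.div_le_div_left hm (by norm_num)
  have h2 : K / 2 + 1 ≤ K := by omega
  omega

/-- `−log(1 − δ) ≤ 2δ` on `[0, ½]` (so summable bad masses give summable radii). [folklore] -/
theorem neg_log_one_sub_le {δ : ℝ} (h0 : 0 ≤ δ) (h1 : δ ≤ 1 / 2) : -Real.log (1 - δ) ≤ 2 * δ := by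
  have hpos : 0 < 1 - δ := by linarith
  have hlog := Real.one_sub_inv_le_log_of_pos hpos
  have hinv : (1 - δ)⁻¹ ≤ 1 + 2 * δ := by
    rw [inv_eq_one_div, div_le_iff₀ hpos]
    nlinarith
  linarith

/-- **THE BODY OF 4′ FOR ONE FAMILY FROM PER-CUT-OFF DESCENT DATA** (`m ≥ 2`, `γ ≥ 0`).  For every cut-off `K ≥ 1`: a measurable good set `G K` of fields one level below
the comparison height `⌊K/m⌋`, a two-run sandwich of the `histGood`-restricted height densities a.e. on `G K` with constant `κ K` and radius `r K` (`Σ r < ∞`), and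
the conditional bad mass `δ K ∈ [0, ½]` of both runs (`Σ δ < ∞`); the minimiser-stability schema `MinimiserStabilityRegPrAt F γ b₀ p₀ m ε₀` (the per-family body of
crux `MinimiserStabilityRegPr`); and, for the descent-free cut-off `K = 0`, an a.e. bound of the 4′ quantity around some constant.  Conclusion: the body of 4′ for
`(F, γ, b₀, p₀, m, ε₀)` — summable radii `r K − log(1 − δ K) + r₃ K ≤ r K + 2δ K + r₃ K` (`K ≥ 1`). [cite: King1986, Thm 3.4 (3.9) p.656] -/
theorem fourPrimeBody_of_descent_family (hγ : 0 ≤ γ) (b₀ p₀ ε₀ : ℝ) {m : ℕ} (hm : 2 ≤ m)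
    (G : ∀ K : ℕ, Set (GaugeField (F.P (K / m + 1)) 0 (Matrix.specialUnitaryGroup (Fin 2) ℂ))) (hG : ∀ K, MeasurableSet (G K))
    (κ r δ : ℕ → ℝ) (hr : Summable r) (hr0 : ∀ K, 0 ≤ r K) (hδs : Summable δ) (hδ : ∀ K, 0 ≤ δ K ∧ δ K ≤ 1 / 2)
    (hcmp : ∀ (K : ℕ) (hK : 1 ≤ K), ∀ᵐ W ∂fieldMeasure (F.P (K / m + 1)) 0 (Matrix.specialUnitaryGroup (Fin 2) ℂ), W ∈ G K →
      Real.exp (κ K - r K) * heightDensity F γ (div_succ_le hm hK) (histGood F ℰp (θBal F.L γ b₀ p₀) K (K / m)) W ≤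
          heightDensity F γ ((div_succ_le hm hK).trans (Nat.le_succ K)) (histGood F ℰp (θBal F.L γ b₀ p₀) (K + 1) (K / m)) W ∧
        heightDensity F γ ((div_succ_le hm hK).trans (Nat.le_succ K)) (histGood F ℰp (θBal F.L γ b₀ p₀) (K + 1) (K / m)) W ≤
          Real.exp (κ K + r K) * heightDensity F γ (div_succ_le hm hK) (histGood F ℰp (θBal F.L γ b₀ p₀) K (K / m)) W)
    (hbadA : ∀ (K : ℕ) (hK : 1 ≤ K), ∀ s, MeasurableSet s →
      ∫ W in (descendTo F ℰp (K / m) (K / m + 1) (Nat.le_succ _)) ⁻¹' s ∩ (G K)ᶜ,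
          heightDensity F γ (div_succ_le hm hK) (histGood F ℰp (θBal F.L γ b₀ p₀) K (K / m)) W
          ∂fieldMeasure (F.P (K / m + 1)) 0 (Matrix.specialUnitaryGroup (Fin 2) ℂ) ≤
        δ K * ∫ V in s, heightDensity F γ (Nat.div_le_self K m) (histGood F ℰp (θBal F.L γ b₀ p₀) K (K / m)) V
          ∂fieldMeasure (F.P (K / m)) 0 (Matrix.specialUnitaryGroup (Fin 2) ℂ))
    (hbadB : ∀ (K : ℕ) (hK : 1 ≤ K), ∀ s, MeasurableSet s →
      ∫ W in (descendTo F ℰp (K / m) (K / m + 1) (Nat.le_succ _)) ⁻¹' s ∩ (G K)ᶜ,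
          heightDensity F γ ((div_succ_le hm hK).trans (Nat.le_succ K)) (histGood F ℰp (θBal F.L γ b₀ p₀) (K + 1) (K / m)) W
          ∂fieldMeasure (F.P (K / m + 1)) 0 (Matrix.specialUnitaryGroup (Fin 2) ℂ) ≤
        δ K * ∫ V in s, heightDensity F γ ((Nat.div_le_self K m).trans (Nat.le_succ K)) (histGood F ℰp (θBal F.L γ b₀ p₀) (K + 1) (K / m)) V
          ∂fieldMeasure (F.P (K / m)) 0 (Matrix.specialUnitaryGroup (Fin 2) ℂ))
    (hmin : MinimiserStabilityRegPrAt F γ b₀ p₀ m ε₀)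
    (hzero : ∀ K : ℕ, K < 1 → ∃ c₀ r₀ : ℝ, ∀ᵐ V ∂fieldMeasure (F.P (K / m)) 0 (Matrix.specialUnitaryGroup (Fin 2) ℂ),
      PlaqSmall (θBal F.L γ b₀ p₀ (K / m)) V →
        0 < heightDensity F γ (Nat.div_le_self K m) (histGood F ℰp (θBal F.L γ b₀ p₀) K (K / m)) V →
        0 < heightDensity F γ ((Nat.div_le_self K m).trans (Nat.le_succ K)) (histGood F ℰp (θBal F.L γ b₀ p₀) (K + 1) (K / m)) V →
          |(Real.log (heightDensity F γ ((Nat.div_le_self K m).trans (Nat.le_succ K))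
                (histGood F ℰp (θBal F.L γ b₀ p₀) (K + 1) (K / m)) V) + bgRegPr' F γ m ε₀ K V) -
            (Real.log (heightDensity F γ (Nat.div_le_self K m) (histGood F ℰp (θBal F.L γ b₀ p₀) K (K / m)) V) + bgRegPr F γ m ε₀ K V) -
              c₀| ≤ r₀) :
    ∃ (r' κ' : ℕ → ℝ), Summable r' ∧ (∀ K, 0 ≤ r' K) ∧
      ∀ K, ∀ᵐ V ∂fieldMeasure (F.P (K / m)) 0 (Matrix.specialUnitaryGroup (Fin 2) ℂ),
        PlaqSmall (θBal F.L γ b₀ p₀ (K / m)) V →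
          0 < heightDensity F γ (Nat.div_le_self K m) (histGood F ℰp (θBal F.L γ b₀ p₀) K (K / m)) V →
          0 < heightDensity F γ ((Nat.div_le_self K m).trans (Nat.le_succ K)) (histGood F ℰp (θBal F.L γ b₀ p₀) (K + 1) (K / m)) V →
            |(Real.log (heightDensity F γ ((Nat.div_le_self K m).trans (Nat.le_succ K))
                  (histGood F ℰp (θBal F.L γ b₀ p₀) (K + 1) (K / m)) V) + bgRegPr' F γ m ε₀ K V) -
              (Real.log (heightDensity F γ (Nat.div_le_self K m) (histGood F ℰp (θBal F.L γ b₀ p₀) K (K / m)) V) + bgRegPr F γ m ε₀ K V) -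
                κ' K| ≤ r' K := by
  obtain ⟨r₃, κ₃, hr₃, hr₃0, hmin'⟩ := hmin
  obtain ⟨c₀, r₀, h0⟩ := hzero 0 Nat.one_pos
  -- radii: the `K = 0` bound on top of the generic summable profile `r + 2δ + r₃`
  refine ⟨fun K => (if K = 0 then max r₀ 0 else 0) + (r K + 2 * δ K + r₃ K),
    fun K => if K = 0 then c₀ else κ K + κ₃ K, ?_, fun K => ?_, fun K => ?_⟩
  · refine Summable.add ?_ ((hr.add (hδs.mul_left 2)).add hr₃)
    refine summable_of_ne_finset_zero (s := {0}) fun K hK => ?_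
    rw [Finset.mem_singleton] at hK
    rw [if_neg hK]
  · have : 0 ≤ (if K = 0 then max r₀ 0 else 0 : ℝ) := by
      split_ifs
      · exact le_max_right _ _
      · exact le_rfl
    nlinarith [hr0 K, (hδ K).1, hr₃0 K]
  · rcases Nat.eq_zero_or_pos K with hK0 | hKpos
    · subst hK0
      filter_upwards [h0] with V hV hs hp hp'
      have h := hV hs hp hp'
      simp only [if_true]
      have hle : r₀ ≤ max r₀ 0 + (r 0 + 2 * δ 0 + r₃ 0) := by
        nlinarith [le_max_left r₀ 0, hr0 0, (hδ 0).1, hr₃0 0]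
      exact h.trans hle
    · have hK : 1 ≤ K := hKpos
      have hK0 : K ≠ 0 := by omega
      have hpair := fourPrime_pair_of_descent F hγ b₀ p₀ ε₀ (div_succ_le hm hK) (hG K)
        (by linarith [(hδ K).2] : δ K < 1) (hcmp K hK) (hbadA K hK) (hbadB K hK) (hmin' K)
      filter_upwards [hpair] with V hV hs hp hp'
      have h := hV hs hp hp'
      simp only [hK0, if_false]
      have hlog := neg_log_one_sub_le (hδ K).1 (hδ K).2
      have hle : r K - Real.log (1 - δ K) + r₃ K ≤ 0 + (r K + 2 * δ K + r₃ K) := by linarith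
      exact h.trans hle

end Assembly


end Summit.QuantumFields.YangMills.Theorems.PrintChi

end
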